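import Mathlib
import HarnessLib.Audit
import Summits.PneNP.PneNP.Theorems.PstarNorUnitCoverTools

/-!
# Small XOR-closed unit families absorb the core: no bridges (ROUND-24, memo §9 R9 / §13 (P3) in the NOR regime)

FRONTIER range-avoidance ladder, rung F-N3, ROUND 24 (cell `pnp-ideate`, planner memo `r24/CORE-BOUND-NOTES.md` §1 (bridges), §9 R9, §13 (P3);
restricted-model proof complexity — nothing here bears on `P` versus `NP`).

Pure combinatorics of the XOR multigraph of a core, closing the covering gap of `PstarNorUnitDirAssembly.card_units_le_five_dir`.  Setting:
`N ⊆ J₀` (chords), `J₀ ∖ N` peelable (a forest), fundamental sets `D e ⊆ J₀ ∖ N` with `D e + e` everywhere even, and the UNIT FAMILY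
`J' := N ∪ ⋃ₑ D e`.  `subset_units`: if `J₀` and `J'` are leafless (every XOR vertex of slot-degree `≥ 2`) and `#J' ≤ 5`, then `J₀ ⊆ J'`.

Proof.  For `t ∈ J₀` the Fredholm alternative gives an everywhere-even `Z ⊆ J₀` through `t` or a vertex labelling `x` with
`x u_j + x v_j = [j = t]` on `J₀` (a cut crossed by `t` alone) — `PstarNorUnitCoverTools.exists_even_or_cut`.  An even `Z` puts `t` in `N` or in
some `D e` (`PstarNorUnitCoverTools.exists_mem_fundamental_of_even`).  A cut is impossible (`false_of_cut`): `J'` is not crossed, a non-empty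
leafless family has `≥ 3` outputs (`three_le_card_of_leafless`), so with `#J' ≤ 5` one side of the cut carries no output of `J'`; the outputs of
`J₀` touching that side form a non-empty sub-forest `S ∋ t` with `#S < #(xverts S)` (`PstarChordBridgeCotree.card_lt_card_xverts`) whose vertices
other than the far end of `t` have full degree `≥ 2` — contradicting `Σ xpdeg = 2·#S` (`false_of_side`).
-/

set_option linter.dupNamespace false -- `Summit.PneNP.PneNP.…`: summit = sub-problem name (D-0017 single-conjunct layout)

open Finset Literature.Computability.Complexity
open Summit.PneNP.PneNP.Theorems.PstarTyped (Typed)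
open Summit.PneNP.PneNP.Theorems.PstarSALevel (varSet bdry SimpleOverlap)
open Summit.PneNP.PneNP.Theorems.PstarCoreBound (XorClosed)
open Summit.PneNP.PneNP.Theorems.PstarXorElimination (pdeg exists_solution_iff)
open Summit.PneNP.PneNP.Theorems.PstarXCore (xpair xverts mem_xpair)
open Summit.PneNP.PneNP.Theorems.PstarCentreFree (vars_mem_varSet)
open Summit.PneNP.PneNP.Theorems.PstarChordBridgeTools (xpdeg)
open Summit.PneNP.PneNP.Theorems.PstarChordBridgeFundamental (xpdeg_insert sum_xpdeg)
open Summit.PneNP.PneNP.Theorems.PstarChordBridgeCotree (Peelable mem_xverts_iff_xpdeg_pos card_lt_card_xverts)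
open Summit.PneNP.PneNP.Theorems.PstarNorUnitCoverTools (three_le_card_of_leafless exists_even_or_cut exists_mem_fundamental_of_even)

namespace Summit.PneNP.PneNP.Theorems.PstarNorUnitCover

variable {n m : ℕ}

/-! ## No cut -/

/-- One side of a cut: if no output of `J'` touches the vertices labelled `c`, `t ∈ J₀ ∖ J'` has exactly one end labelled `c`, every other output
of `J₀` has both or no end labelled `c`, `J₀` is leafless and `J₀ ∖ J'` peelable — contradiction (the outputs touching label `c` form a forest with
too many edges). -/
theorem false_of_side (I : LocalMap 4 n m) (hI : I.IsPure xorAndPred) {J₀ J' : Finset (Fin m)}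
    (hL₀ : ∀ w ∈ xverts I J₀, 2 ≤ xpdeg I J₀ w) (hP : Peelable I (J₀ \ J')) {t : Fin m} (ht : t ∈ J₀ \ J') {x : Fin n → ZMod 2}
    (hx : ∀ j ∈ J₀, j ≠ t → x (I.vars j 0) = x (I.vars j 1)) (c : ZMod 2) (hJ'c : ∀ j ∈ J', x (I.vars j 0) ≠ c)
    {a v₀ : Fin n} (ha : a ∈ xpair I t) (hac : x a = c) (hv₀ : v₀ ∈ xpair I t) (hv₀c : x v₀ ≠ c) : False := by
  classical
  set S : Finset (Fin m) := J₀.filter fun j => x (I.vars j 0) = c ∨ x (I.vars j 1) = c with hS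
  -- `S` avoids `J'`, so it is a forest
  have hSJ : S ⊆ J₀ \ J' := by
    intro j hj
    rw [hS, mem_filter] at hj
    refine mem_sdiff.2 ⟨hj.1, fun hjJ' => ?_⟩
    have hjt : j ≠ t := fun h => (mem_sdiff.1 ht).2 (h ▸ hjJ')
    rcases hj.2 with h | h
    · exact hJ'c j hjJ' h
    · exact hJ'c j hjJ' ((hx j hj.1 hjt).trans h)
  have htS : t ∈ S := by
    rw [hS, mem_filter]
    refine ⟨(mem_sdiff.1 ht).1, ?_⟩
    rcases (mem_xpair I).1 ha with h | h
    · exact Or.inl (h ▸ hac)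
    · exact Or.inr (h ▸ hac)
  have hlt := card_lt_card_xverts I hI S (hP.subset hSJ) ⟨t, htS⟩
  -- every vertex of `S` other than `v₀` is labelled `c` and has full degree in `S`
  have hav₀ : a ≠ v₀ := fun h => hv₀c (h ▸ hac)
  have hlab : ∀ w ∈ xverts I S, w ≠ v₀ → x w = c := by
    intro w hw hwv
    unfold PstarXCore.xverts at hw
    obtain ⟨j, hj, hwj⟩ := mem_biUnion.1 hw
    have hj' := (mem_filter.1 hj)
    by_cases hjt : j = t
    · subst hjt
      -- `w ∈ {a, v₀} = xpair t`, `w ≠ v₀`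
      have h01 : I.vars j 0 ≠ I.vars j 1 := fun h => absurd (hI.2 j h) (by decide)
      rcases (mem_xpair I).1 hwj with hw | hw <;> rcases (mem_xpair I).1 ha with h1 | h1 <;>
        rcases (mem_xpair I).1 hv₀ with h2 | h2
      all_goals first
        | exact absurd (h1.trans h2.symm) hav₀
        | exact (hw.trans h1.symm) ▸ hac
        | exact absurd (hw.trans h2.symm) hwv
    · have heq := hx j hj'.1 hjt
      rcases (mem_xpair I).1 hwj with hw | hw <;> rcases hj'.2 with h | h
      · exact hw ▸ h
      · exact hw ▸ (heq.trans h)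
      · exact hw ▸ (heq.symm.trans h)
      · exact hw ▸ h
  have hfull : ∀ w, x w = c → xpdeg I S w = xpdeg I J₀ w := by
    intro w hwc
    unfold xpdeg pdeg
    congr 1
    · congr 1
      ext j
      simp only [hS, mem_filter]
      constructor
      · rintro ⟨⟨hj, -⟩, h⟩; exact ⟨hj, h⟩
      · rintro ⟨hj, h⟩; exact ⟨⟨hj, Or.inl (h.symm ▸ hwc)⟩, h⟩
    · congr 1
      ext j
      simp only [hS, mem_filter]
      constructor
      · rintro ⟨⟨hj, -⟩, h⟩; exact ⟨hj, h⟩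
      · rintro ⟨hj, h⟩; exact ⟨⟨hj, Or.inr (h.symm ▸ hwc)⟩, h⟩
  have hSsub : S ⊆ J₀ := filter_subset _ _
  have hxv : xverts I S ⊆ xverts I J₀ := by
    intro w hw
    unfold PstarXCore.xverts at hw ⊢
    obtain ⟨j, hj, hwj⟩ := mem_biUnion.1 hw
    exact mem_biUnion.2 ⟨j, hSsub hj, hwj⟩
  have hdeg : ∀ w ∈ (xverts I S).erase v₀, 2 ≤ xpdeg I S w := by
    intro w hw
    obtain ⟨hwv, hw⟩ := mem_erase.1 hw
    rw [hfull w (hlab w hw hwv)]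
    exact hL₀ w (hxv hw)
  have hv₀S : v₀ ∈ xverts I S := by
    unfold PstarXCore.xverts; exact mem_biUnion.2 ⟨t, htS, hv₀⟩
  have hv₀deg : 1 ≤ xpdeg I S v₀ := (mem_xverts_iff_xpdeg_pos I S v₀).1 hv₀S
  -- degree count
  have h1 : 2 * ((xverts I S).erase v₀).card ≤ ∑ w ∈ (xverts I S).erase v₀, xpdeg I S w := by
    rw [mul_comm, card_eq_sum_ones, sum_mul]
    exact sum_le_sum fun w hw => by rw [one_mul]; exact hdeg w hw
  have h2 : ∑ w ∈ xverts I S, xpdeg I S w ≤ ∑ w, xpdeg I S w :=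
    sum_le_sum_of_subset_of_nonneg (subset_univ _) fun _ _ _ => Nat.zero_le _
  rw [← add_sum_erase _ _ hv₀S] at h2
  rw [sum_xpdeg] at h2
  have h3 := card_erase_of_mem hv₀S
  have h4 : 0 < (xverts I S).card := card_pos.2 ⟨v₀, hv₀S⟩
  omega

/-- **No cut is crossed by a single non-unit output.**  `J' ⊆ J₀` leafless with `#J' ≤ 5`, `J₀` leafless, `J₀ ∖ J'` peelable, `t ∈ J₀ ∖ J'`:
no vertex labelling is crossed by `t` alone. -/
theorem false_of_cut (I : LocalMap 4 n m) (hI : I.IsPure xorAndPred) (hS : SimpleOverlap I) {J₀ J' : Finset (Fin m)}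
    (hL₀ : ∀ w ∈ xverts I J₀, 2 ≤ xpdeg I J₀ w) (hL' : ∀ w ∈ xverts I J', 2 ≤ xpdeg I J' w) (h5 : J'.card ≤ 5)
    (hP : Peelable I (J₀ \ J')) {t : Fin m} (ht : t ∈ J₀ \ J') (hJ' : J' ⊆ J₀) {x : Fin n → ZMod 2}
    (hx : ∀ j ∈ J₀, x (I.vars j 0) + x (I.vars j 1) = if j = t then 1 else 0) : False := by
  classical
  have h2 : ∀ a b : ZMod 2, a + b = 0 → a = b := by decide
  have hx' : ∀ j ∈ J₀, j ≠ t → x (I.vars j 0) = x (I.vars j 1) := fun j hj hjt => h2 _ _ (by rw [hx j hj, if_neg hjt])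
  have htJ₀ : t ∈ J₀ := (mem_sdiff.1 ht).1
  have htJ' : t ∉ J' := (mem_sdiff.1 ht).2
  -- the part of `J'` on side `c` is leafless
  have hside : ∀ c : ZMod 2, (J'.filter fun j => x (I.vars j 0) = c).Nonempty → 3 ≤ (J'.filter fun j => x (I.vars j 0) = c).card := by
    intro c hne
    refine three_le_card_of_leafless I hI hS hne fun w hw => ?_
    -- `w` is labelled `c`; all its `J'`-outputs are on side `c`
    unfold PstarXCore.xverts at hw
    obtain ⟨j, hj, hwj⟩ := mem_biUnion.1 hw
    obtain ⟨hjJ', hjc⟩ := mem_filter.1 hj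
    have hjt : j ≠ t := fun h => htJ' (h ▸ hjJ')
    have hwc : x w = c := by
      rcases (mem_xpair I).1 hwj with h | h
      · exact h ▸ hjc
      · exact h ▸ ((hx' j (hJ' hjJ') hjt).symm.trans hjc)
    have hfull : xpdeg I (J'.filter fun j => x (I.vars j 0) = c) w = xpdeg I J' w := by
      unfold xpdeg pdeg
      congr 1
      · congr 1
        ext i
        simp only [mem_filter]
        constructor
        · rintro ⟨⟨hi, -⟩, h⟩; exact ⟨hi, h⟩
        · rintro ⟨hi, h⟩; exact ⟨⟨hi, h.symm ▸ hwc⟩, h⟩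
      · congr 1
        ext i
        simp only [mem_filter]
        constructor
        · rintro ⟨⟨hi, -⟩, h⟩; exact ⟨hi, h⟩
        · rintro ⟨hi, h⟩
          have hit : i ≠ t := fun h' => htJ' (h' ▸ hi)
          exact ⟨⟨hi, (hx' i (hJ' hi) hit).trans (h.symm ▸ hwc)⟩, h⟩
    rw [hfull]
    refine hL' w ?_
    unfold PstarXCore.xverts
    exact mem_biUnion.2 ⟨j, hjJ', hwj⟩
  -- one side carries no output of `J'`
  obtain ⟨c, hc⟩ : ∃ c : ZMod 2, ∀ j ∈ J', x (I.vars j 0) ≠ c := by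
    by_contra hno
    push Not at hno
    have hne : ∀ c : ZMod 2, (J'.filter fun j => x (I.vars j 0) = c).Nonempty := fun c => by
      obtain ⟨j, hj, hjc⟩ := hno c
      exact ⟨j, mem_filter.2 ⟨hj, hjc⟩⟩
    have hsum : (J'.filter fun j => x (I.vars j 0) = 0).card + (J'.filter fun j => x (I.vars j 0) = 1).card = J'.card := by
      have h01 : ∀ a : ZMod 2, a = 1 ↔ ¬ a = 0 := by decide
      rw [filter_congr (fun j _ => h01 (x (I.vars j 0))), card_filter_add_card_filter_not]
    have := hside 0 (hne 0)
    have := hside 1 (hne 1)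
    omega
  -- the end of `t` labelled `c` and the other end
  have ht1 : x (I.vars t 0) + x (I.vars t 1) = 1 := by rw [hx t htJ₀, if_pos rfl]
  by_cases h0 : x (I.vars t 0) = c
  · have h1 : x (I.vars t 1) ≠ c := by
      have : ∀ a b c : ZMod 2, a + b = 1 → a = c → b ≠ c := by decide
      exact this _ _ _ ht1 h0
    exact false_of_side I hI hL₀ hP ht hx' c hc ((mem_xpair I).2 (Or.inl rfl)) h0 ((mem_xpair I).2 (Or.inr rfl)) h1
  · have h1 : x (I.vars t 1) = c := by
      have : ∀ a b c : ZMod 2, a + b = 1 → a ≠ c → b = c := by decide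
      exact this _ _ _ ht1 h0
    exact false_of_side I hI hL₀ hP ht hx' c hc ((mem_xpair I).2 (Or.inr rfl)) h1 ((mem_xpair I).2 (Or.inl rfl)) h0

/-! ## The covering theorem -/

/-- **Small leafless unit families absorb the core.**  `N ⊆ J₀`, `J₀ ∖ N` peelable, fundamental sets `D e ⊆ J₀ ∖ N` with `D e + e` everywhere
even; if `J₀` and `J' := N ∪ ⋃ₑ D e` are leafless and `#J' ≤ 5` then `J₀ ⊆ J'` (no bridges). -/
theorem subset_units (I : LocalMap 4 n m) (hI : I.IsPure xorAndPred) (hS : SimpleOverlap I) {J₀ N : Finset (Fin m)}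
    {D : Fin m → Finset (Fin m)} (hN : N ⊆ J₀) (hP : Peelable I (J₀ \ N)) (hD : ∀ e ∈ N, D e ⊆ J₀ \ N)
    (hDeven : ∀ e ∈ N, ∀ w, Even (xpdeg I (insert e (D e)) w)) (hL₀ : ∀ w ∈ xverts I J₀, 2 ≤ xpdeg I J₀ w)
    (hL' : ∀ w ∈ xverts I (N ∪ N.biUnion D), 2 ≤ xpdeg I (N ∪ N.biUnion D) w) (h5 : (N ∪ N.biUnion D).card ≤ 5) :
    J₀ ⊆ N ∪ N.biUnion D := by
  classical
  intro t ht
  by_contra htJ'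
  have htN : t ∉ N := fun h => htJ' (mem_union_left _ h)
  have hJ'sub : N ∪ N.biUnion D ⊆ J₀ := by
    intro j hj
    rcases mem_union.1 hj with h | h
    · exact hN h
    · obtain ⟨e, he, hjD⟩ := mem_biUnion.1 h
      exact (mem_sdiff.1 (hD e he hjD)).1
  rcases exists_even_or_cut I J₀ ht with ⟨Z, hZ, htZ, hZeven⟩ | ⟨x, hx⟩
  · obtain ⟨e, he, htD⟩ := exists_mem_fundamental_of_even I hP hD hDeven hZ hZeven htZ htN
    exact htJ' (mem_union_right _ (mem_biUnion.2 ⟨e, (mem_inter.1 he).2, htD⟩))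
  · have hsub : J₀ \ (N ∪ N.biUnion D) ⊆ J₀ \ N := sdiff_subset_sdiff (Subset.refl _) subset_union_left
    exact false_of_cut I hI hS hL₀ hL' h5 (hP.subset hsub) (mem_sdiff.2 ⟨ht, htJ'⟩) hJ'sub hx

end Summit.PneNP.PneNP.Theorems.PstarNorUnitCover
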